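import Summits.Ventures.Crystal3D.Theorems.StickyWulffConstantCoaxialWallLawPayerInstance
import HarnessLib

/-!
# The census-free payer count for END PAIRS: a family-blind capacity bound

HONEST FRAMING. Part of the venture `Summits/Ventures/Crystal3D` (cell `crystal3d-full`), helper for the crux
`CoaxialWallLaw` (stmt-Ventures-19481) of `route-Ventures-StickyWulffConstant`, REGISTERED line `WallLedgerF`
(planner cf-p1), open stub `stub_coaxialTwoSlabAdhesion` (general fillings).  Rung credit only; F-C1 not moved.
Brick (B3a) of memo HOME/wall-19481-p2/F-MULTISOURCE.md (19481-p2 g4).  The tail of 19481-p1's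
`word_sources_le_lists_payers` (`…PayerInstance`: ends at unsaturated balls `≤ 12` per payer, ends at saturated balls
charged half to each of two unsaturated contact neighbours, `≤ 66` per payer) uses of an end state only its BALL, its
PREDECESSOR ball (a contact, distinct ends at one ball having distinct predecessors) and the two-payer dichotomy.  This
file states that tail for an abstract finite set of (end ball, predecessor ball) PAIRS, so that the ends of SEVERAL word
families — all rising root slots, both plates — can be poured into ONE capacity bound once their pairs are known to be
distinct (LEMMA X, `…EndUniqueMulti`):

**Theorem (`card_endPairs_le_payers`).**  `X` `1`-separated; `T` a finite set of pairs `(b, q)` with `b, q ∈ X`,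
`dist b q = 1`, `b` in the window `−R₀−1 ≤ b₂ < h+R₀+1`, and for each pair either `deg b ≤ 11` or `b` has two distinct
contact neighbours of degree `≤ 11`.  Then `#T ≤ 78 · #{z ∈ X : deg z ≤ 11, −R₀−2 ≤ z₂ ≤ h+R₀+2}`.

WHAT THIS IS NOT: not the stub; the per-family pair sets and their disjointness are bricks B3b; F-C1 not moved.
-/

noncomputable section

namespace Summit.Ventures.Crystal3D.Theorems

open Summit.Ventures.Crystal3D Finset
open scoped InnerProductSpace

open scoped Classical in
/-- **The family-blind payer count for end pairs.**  See the module docstring. -/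
theorem card_endPairs_le_payers {X : Finset (EuclideanSpace ℝ (Fin 3))}
    (hX : ∀ p ∈ X, ∀ q ∈ X, p ≠ q → 1 ≤ dist p q)
    (T : Finset (EuclideanSpace ℝ (Fin 3) × EuclideanSpace ℝ (Fin 3))) {R₀ h : ℝ}
    (hT : ∀ bq ∈ T, bq.1 ∈ X ∧ bq.2 ∈ X ∧ dist bq.1 bq.2 = 1 ∧ -R₀ - 1 ≤ bq.1 2 ∧ bq.1 2 < h + R₀ + 1)
    (hpay : ∀ bq ∈ T, (X.filter fun q => dist bq.1 q = 1).card ≤ 11 ∨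
      ∃ z₁ ∈ X, ∃ z₂ ∈ X, z₁ ≠ z₂ ∧ dist bq.1 z₁ = 1 ∧ dist bq.1 z₂ = 1 ∧
        (X.filter fun q => dist z₁ q = 1).card ≤ 11 ∧ (X.filter fun q => dist z₂ q = 1).card ≤ 11) :
    T.card ≤ 78 * (X.filter fun z => (X.filter fun q => dist z q = 1).card ≤ 11 ∧
      -R₀ - 1 - 1 ≤ z 2 ∧ z 2 ≤ h + R₀ + 1 + 1).card := by
  set PAY := X.filter fun z => (X.filter fun q => dist z q = 1).card ≤ 11 ∧
    -R₀ - 1 - 1 ≤ z 2 ∧ z 2 ≤ h + R₀ + 1 + 1 with hPAY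
  -- the pairs with a given end ball: at most `deg ≤ 12` (distinct predecessors)
  set Rb : EuclideanSpace ℝ (Fin 3) → Finset (EuclideanSpace ℝ (Fin 3) × EuclideanSpace ℝ (Fin 3)) :=
    fun b => T.filter fun bq => bq.1 = b with hRb
  have hRbcard : ∀ b, (Rb b).card ≤ (X.filter fun q => dist b q = 1).card := by
    intro b
    refine Finset.card_le_card_of_injOn (fun bq => bq.2) ?_ ?_
    · intro bq hbq
      obtain ⟨hbqT, hb⟩ := mem_filter.1 hbq
      obtain ⟨-, hqX, hd, -⟩ := hT bq hbqT
      exact mem_coe.2 (mem_filter.2 ⟨hqX, by rw [← hb]; exact hd⟩)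
    · intro bq hbq bq' hbq' heq
      obtain ⟨-, hb⟩ := mem_filter.1 (mem_coe.1 hbq)
      obtain ⟨-, hb'⟩ := mem_filter.1 (mem_coe.1 hbq')
      exact Prod.ext (hb.trans hb'.symm) heq
  have hRb12 : ∀ b, (Rb b).card ≤ 12 := fun b => (hRbcard b).trans (card_filter_dist_eq_one_le_twelve X hX b)
  have hTRb : ∀ bq ∈ T, bq ∈ Rb bq.1 := fun bq hbq => mem_filter.2 ⟨hbq, rfl⟩
  -- a contact neighbour of an end ball is in the widened window
  have hnbwin : ∀ bq ∈ T, ∀ z : EuclideanSpace ℝ (Fin 3), dist bq.1 z = 1 →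
      -R₀ - 1 - 1 ≤ z 2 ∧ z 2 ≤ h + R₀ + 1 + 1 := by
    intro bq hbq z hdz
    obtain ⟨-, -, -, h1, h2⟩ := hT bq hbq
    have hsq := sq_sub_apply_le_dist_sq z bq.1 2
    rw [dist_comm, hdz, one_pow] at hsq
    have habs : |z 2 - bq.1 2| ≤ 1 := by rw [← sq_le_one_iff_abs_le_one]; exact hsq
    obtain ⟨hl, hu'⟩ := abs_le.1 habs
    exact ⟨by linarith, by linarith⟩
  -- split: unsaturated own ball / saturated own ball
  set Eu := T.filter fun bq => (X.filter fun q => dist bq.1 q = 1).card ≤ 11 with hEu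
  set Es := T.filter fun bq => ¬ (X.filter fun q => dist bq.1 q = 1).card ≤ 11 with hEs
  have hsplit : T.card = Eu.card + Es.card := by
    rw [hEu, hEs]; exact (card_filter_add_card_filter_not _).symm
  -- (1) ends at unsaturated balls: `≤ 12` per payer
  have hEu_le : Eu.card ≤ 12 * PAY.card := by
    have hcov : Eu ⊆ PAY.biUnion fun z => Rb z := by
      intro bq hbq
      obtain ⟨hbqT, hdeg⟩ := mem_filter.1 hbq
      obtain ⟨hbX, -, -, h1, h2⟩ := hT bq hbqT
      rw [mem_biUnion]
      exact ⟨bq.1, mem_filter.2 ⟨hbX, hdeg, by linarith, by linarith⟩, hTRb bq hbqT⟩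
    calc Eu.card ≤ (PAY.biUnion fun z => Rb z).card := card_le_card hcov
      _ ≤ ∑ z ∈ PAY, (Rb z).card := card_biUnion_le
      _ ≤ ∑ z ∈ PAY, 12 := sum_le_sum fun z _ => hRb12 z
      _ = 12 * PAY.card := by rw [sum_const, smul_eq_mul, mul_comm]
  -- (2) ends at saturated balls: two unsaturated contact neighbours each, `≤ 11·12` per payer
  have hEs_two : ∀ bq ∈ Es, 2 ≤ (PAY.filter fun z => dist bq.1 z = 1).card := by
    intro bq hbq
    obtain ⟨hbqT, hdeg⟩ := mem_filter.1 hbq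
    rcases hpay bq hbqT with h11 | ⟨z₁, hz₁, z₂, hz₂, hne, hd₁, hd₂, hc₁, hc₂⟩
    · exact absurd h11 hdeg
    · have hz₁P : z₁ ∈ PAY.filter fun z => dist bq.1 z = 1 :=
        mem_filter.2 ⟨mem_filter.2 ⟨hz₁, hc₁, hnbwin bq hbqT z₁ hd₁⟩, hd₁⟩
      have hz₂P : z₂ ∈ PAY.filter fun z => dist bq.1 z = 1 :=
        mem_filter.2 ⟨mem_filter.2 ⟨hz₂, hc₂, hnbwin bq hbqT z₂ hd₂⟩, hd₂⟩
      calc 2 = ({z₁, z₂} : Finset _).card := (card_pair hne).symm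
        _ ≤ _ := card_le_card (by
          intro z hz
          rcases mem_insert.1 hz with rfl | hz
          · exact hz₁P
          · rw [mem_singleton.1 hz]; exact hz₂P)
  have hfib : ∀ z ∈ PAY, (Es.filter fun bq => dist bq.1 z = 1).card ≤ 11 * 12 := by
    intro z hz
    obtain ⟨-, hdeg, -, -⟩ := mem_filter.1 hz
    have hcov : (Es.filter fun bq => dist bq.1 z = 1) ⊆ (X.filter fun q => dist z q = 1).biUnion fun b => Rb b := by
      intro bq hbq
      obtain ⟨hbqEs, hdz⟩ := mem_filter.1 hbq
      have hbqT : bq ∈ T := (mem_filter.1 hbqEs).1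
      rw [mem_biUnion]
      exact ⟨bq.1, mem_filter.2 ⟨(hT bq hbqT).1, by rw [dist_comm]; exact hdz⟩, hTRb bq hbqT⟩
    calc (Es.filter fun bq => dist bq.1 z = 1).card
        ≤ ((X.filter fun q => dist z q = 1).biUnion fun b => Rb b).card := card_le_card hcov
      _ ≤ ∑ b ∈ X.filter (fun q => dist z q = 1), (Rb b).card := card_biUnion_le
      _ ≤ ∑ b ∈ X.filter (fun q => dist z q = 1), 12 := sum_le_sum fun b _ => hRb12 b
      _ = 12 * (X.filter fun q => dist z q = 1).card := by rw [sum_const, smul_eq_mul, mul_comm]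
      _ ≤ 11 * 12 := by omega
  have hEs_le : 2 * Es.card ≤ 132 * PAY.card := by
    have hdc := Finset.sum_card_bipartiteAbove_eq_sum_card_bipartiteBelow
      (s := Es) (t := PAY) (r := fun bq z => dist bq.1 z = 1)
    calc 2 * Es.card = ∑ bq ∈ Es, 2 := by rw [sum_const, smul_eq_mul, mul_comm]
      _ ≤ ∑ bq ∈ Es, (PAY.bipartiteAbove (fun bq z => dist bq.1 z = 1) bq).card :=
          sum_le_sum fun bq hbq => hEs_two bq hbq
      _ = ∑ z ∈ PAY, (Es.bipartiteBelow (fun bq z => dist bq.1 z = 1) z).card := hdc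
      _ ≤ ∑ z ∈ PAY, 11 * 12 := sum_le_sum fun z hz => hfib z hz
      _ = 132 * PAY.card := by rw [sum_const, smul_eq_mul]; ring
  omega

open scoped Classical in
/-- **The family-blind payer count for end pairs, CLOSED end window** `−R₀−1 ≤ b₂ ≤ h+R₀+1` (two-plate form: the
end pairs of the top plate's families, pulled back through the cell mirror `z ↦ h − z`, have `−R₀−1 < b₂ ≤ h+R₀+1`;
memo HOME/wall-19481-p2/F-NEXT-SPEC.md §S1 (L1)).  Same proof. -/
theorem card_endPairs_le_payers_closed {X : Finset (EuclideanSpace ℝ (Fin 3))}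
    (hX : ∀ p ∈ X, ∀ q ∈ X, p ≠ q → 1 ≤ dist p q)
    (T : Finset (EuclideanSpace ℝ (Fin 3) × EuclideanSpace ℝ (Fin 3))) {R₀ h : ℝ}
    (hT : ∀ bq ∈ T, bq.1 ∈ X ∧ bq.2 ∈ X ∧ dist bq.1 bq.2 = 1 ∧ -R₀ - 1 ≤ bq.1 2 ∧ bq.1 2 ≤ h + R₀ + 1)
    (hpay : ∀ bq ∈ T, (X.filter fun q => dist bq.1 q = 1).card ≤ 11 ∨
      ∃ z₁ ∈ X, ∃ z₂ ∈ X, z₁ ≠ z₂ ∧ dist bq.1 z₁ = 1 ∧ dist bq.1 z₂ = 1 ∧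
        (X.filter fun q => dist z₁ q = 1).card ≤ 11 ∧ (X.filter fun q => dist z₂ q = 1).card ≤ 11) :
    T.card ≤ 78 * (X.filter fun z => (X.filter fun q => dist z q = 1).card ≤ 11 ∧
      -R₀ - 1 - 1 ≤ z 2 ∧ z 2 ≤ h + R₀ + 1 + 1).card := by
  set PAY := X.filter fun z => (X.filter fun q => dist z q = 1).card ≤ 11 ∧
    -R₀ - 1 - 1 ≤ z 2 ∧ z 2 ≤ h + R₀ + 1 + 1 with hPAY
  -- the pairs with a given end ball: at most `deg ≤ 12` (distinct predecessors)
  set Rb : EuclideanSpace ℝ (Fin 3) → Finset (EuclideanSpace ℝ (Fin 3) × EuclideanSpace ℝ (Fin 3)) :=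
    fun b => T.filter fun bq => bq.1 = b with hRb
  have hRbcard : ∀ b, (Rb b).card ≤ (X.filter fun q => dist b q = 1).card := by
    intro b
    refine Finset.card_le_card_of_injOn (fun bq => bq.2) ?_ ?_
    · intro bq hbq
      obtain ⟨hbqT, hb⟩ := mem_filter.1 hbq
      obtain ⟨-, hqX, hd, -⟩ := hT bq hbqT
      exact mem_coe.2 (mem_filter.2 ⟨hqX, by rw [← hb]; exact hd⟩)
    · intro bq hbq bq' hbq' heq
      obtain ⟨-, hb⟩ := mem_filter.1 (mem_coe.1 hbq)
      obtain ⟨-, hb'⟩ := mem_filter.1 (mem_coe.1 hbq')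
      exact Prod.ext (hb.trans hb'.symm) heq
  have hRb12 : ∀ b, (Rb b).card ≤ 12 := fun b => (hRbcard b).trans (card_filter_dist_eq_one_le_twelve X hX b)
  have hTRb : ∀ bq ∈ T, bq ∈ Rb bq.1 := fun bq hbq => mem_filter.2 ⟨hbq, rfl⟩
  -- a contact neighbour of an end ball is in the widened window
  have hnbwin : ∀ bq ∈ T, ∀ z : EuclideanSpace ℝ (Fin 3), dist bq.1 z = 1 →
      -R₀ - 1 - 1 ≤ z 2 ∧ z 2 ≤ h + R₀ + 1 + 1 := by
    intro bq hbq z hdz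
    obtain ⟨-, -, -, h1, h2⟩ := hT bq hbq
    have hsq := sq_sub_apply_le_dist_sq z bq.1 2
    rw [dist_comm, hdz, one_pow] at hsq
    have habs : |z 2 - bq.1 2| ≤ 1 := by rw [← sq_le_one_iff_abs_le_one]; exact hsq
    obtain ⟨hl, hu'⟩ := abs_le.1 habs
    exact ⟨by linarith, by linarith⟩
  -- split: unsaturated own ball / saturated own ball
  set Eu := T.filter fun bq => (X.filter fun q => dist bq.1 q = 1).card ≤ 11 with hEu
  set Es := T.filter fun bq => ¬ (X.filter fun q => dist bq.1 q = 1).card ≤ 11 with hEs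
  have hsplit : T.card = Eu.card + Es.card := by
    rw [hEu, hEs]; exact (card_filter_add_card_filter_not _).symm
  -- (1) ends at unsaturated balls: `≤ 12` per payer
  have hEu_le : Eu.card ≤ 12 * PAY.card := by
    have hcov : Eu ⊆ PAY.biUnion fun z => Rb z := by
      intro bq hbq
      obtain ⟨hbqT, hdeg⟩ := mem_filter.1 hbq
      obtain ⟨hbX, -, -, h1, h2⟩ := hT bq hbqT
      rw [mem_biUnion]
      exact ⟨bq.1, mem_filter.2 ⟨hbX, hdeg, by linarith, by linarith⟩, hTRb bq hbqT⟩
    calc Eu.card ≤ (PAY.biUnion fun z => Rb z).card := card_le_card hcov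
      _ ≤ ∑ z ∈ PAY, (Rb z).card := card_biUnion_le
      _ ≤ ∑ z ∈ PAY, 12 := sum_le_sum fun z _ => hRb12 z
      _ = 12 * PAY.card := by rw [sum_const, smul_eq_mul, mul_comm]
  -- (2) ends at saturated balls: two unsaturated contact neighbours each, `≤ 11·12` per payer
  have hEs_two : ∀ bq ∈ Es, 2 ≤ (PAY.filter fun z => dist bq.1 z = 1).card := by
    intro bq hbq
    obtain ⟨hbqT, hdeg⟩ := mem_filter.1 hbq
    rcases hpay bq hbqT with h11 | ⟨z₁, hz₁, z₂, hz₂, hne, hd₁, hd₂, hc₁, hc₂⟩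
    · exact absurd h11 hdeg
    · have hz₁P : z₁ ∈ PAY.filter fun z => dist bq.1 z = 1 :=
        mem_filter.2 ⟨mem_filter.2 ⟨hz₁, hc₁, hnbwin bq hbqT z₁ hd₁⟩, hd₁⟩
      have hz₂P : z₂ ∈ PAY.filter fun z => dist bq.1 z = 1 :=
        mem_filter.2 ⟨mem_filter.2 ⟨hz₂, hc₂, hnbwin bq hbqT z₂ hd₂⟩, hd₂⟩
      calc 2 = ({z₁, z₂} : Finset _).card := (card_pair hne).symm
        _ ≤ _ := card_le_card (by
          intro z hz
          rcases mem_insert.1 hz with rfl | hz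
          · exact hz₁P
          · rw [mem_singleton.1 hz]; exact hz₂P)
  have hfib : ∀ z ∈ PAY, (Es.filter fun bq => dist bq.1 z = 1).card ≤ 11 * 12 := by
    intro z hz
    obtain ⟨-, hdeg, -, -⟩ := mem_filter.1 hz
    have hcov : (Es.filter fun bq => dist bq.1 z = 1) ⊆ (X.filter fun q => dist z q = 1).biUnion fun b => Rb b := by
      intro bq hbq
      obtain ⟨hbqEs, hdz⟩ := mem_filter.1 hbq
      have hbqT : bq ∈ T := (mem_filter.1 hbqEs).1
      rw [mem_biUnion]
      exact ⟨bq.1, mem_filter.2 ⟨(hT bq hbqT).1, by rw [dist_comm]; exact hdz⟩, hTRb bq hbqT⟩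
    calc (Es.filter fun bq => dist bq.1 z = 1).card
        ≤ ((X.filter fun q => dist z q = 1).biUnion fun b => Rb b).card := card_le_card hcov
      _ ≤ ∑ b ∈ X.filter (fun q => dist z q = 1), (Rb b).card := card_biUnion_le
      _ ≤ ∑ b ∈ X.filter (fun q => dist z q = 1), 12 := sum_le_sum fun b _ => hRb12 b
      _ = 12 * (X.filter fun q => dist z q = 1).card := by rw [sum_const, smul_eq_mul, mul_comm]
      _ ≤ 11 * 12 := by omega
  have hEs_le : 2 * Es.card ≤ 132 * PAY.card := by
    have hdc := Finset.sum_card_bipartiteAbove_eq_sum_card_bipartiteBelow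
      (s := Es) (t := PAY) (r := fun bq z => dist bq.1 z = 1)
    calc 2 * Es.card = ∑ bq ∈ Es, 2 := by rw [sum_const, smul_eq_mul, mul_comm]
      _ ≤ ∑ bq ∈ Es, (PAY.bipartiteAbove (fun bq z => dist bq.1 z = 1) bq).card :=
          sum_le_sum fun bq hbq => hEs_two bq hbq
      _ = ∑ z ∈ PAY, (Es.bipartiteBelow (fun bq z => dist bq.1 z = 1) z).card := hdc
      _ ≤ ∑ z ∈ PAY, 11 * 12 := sum_le_sum fun z hz => hfib z hz
      _ = 132 * PAY.card := by rw [sum_const, smul_eq_mul]; ring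
  omega

end Summit.Ventures.Crystal3D.Theorems

end
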